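import Summits.ValiantsHypothesis.ValiantsHypothesis.Theorems.KPlusLogSqLawTridiagonalRealStatic

/-!
# Route «KPlusLogSqLaw», crux `WeakLifting` (stmt-ValiantsHypothesis-19561) — REAL side of the tridiagonal sector:
# static definite symmetric tridiagonal witnesses with `m` positive zeros for `m = 6, 7` (the boosting chain, part 1 of 2)

HONEST FRAMING.  Helper theorems (`--supports stmt-ValiantsHypothesis-19561 --as helper`), seat val-sym-lift-p3 (g8), cell `pub-symmetroid`,
2026-08-27.  Two (of four; sizes 8, 9 are in `…TridiagonalRealStaticChain89`) explicit STATIC DEFINITE symmetric tridiagonal matrices of monomials and their root certificates, computed through the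
continuant normal form `StaticTridiagonalReal.det_ctPath` (parent file `…TridiagonalRealStatic`); together with `…TridiagonalRealStaticFive`
(`m = 5`, p549470) and `…TridiagonalRealStatic` §4 (`m = 10`, p551007) they put the located floor «`m` positive zeros on `m − 1` edges for every
`5 ≤ m ≤ 10`» in the kernel.  Nothing here is an upper bound; nothing bears on `stub_tridiagonalSectorB` in its window, on `WeakLifting`, on
Conjecture B, on `TropicalB` (stmt-19771), on `MatrixDescartes` (stmt-18050) or on VP ≠ VNP.

THE CHAIN (seat memo REAL-STATIC-TRIDIAGONAL-liftp3g8.md §3–§4, tools/chain67.py, chain89.py).  Start from the `m = 5` block with edge weights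
`W = (x⁻¹, x/4, 4x, x¹⁰)` (five zeros clustered around `x = 1`) and append, one at a time, ever FASTER edges whose weight crosses `1` inside the
cluster: `W₅ = x⁻¹²/64`, `W₆ = x⁴⁰/256`, `W₇ = x⁻¹⁰⁰/4096`, `W₈ = x⁴⁰⁰/65536`.  Each appended edge adds exactly one zero («boost»:
`Z(p_{m+1}) ≥ #{p_m = 0 on one side} + #{p_{m−1} = 0 on the other side} + [pivot > 0]`), so the prefixes of ONE path matrix — diagonal
`(X, 1, 4X, 1, 1, 64·X¹², 4, 1024·X¹⁰⁰, 64)`, off-diagonal `(1, X, 4X, X⁵, 1, X²⁶, 1, X²⁵⁰)` — have `6, 7, 8, 9` distinct positive determinant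
zeros at sizes `6, 7, 8, 9` (`le_card_posRoots_six` … `_nine`; Descartes is not tight here: `9, 15, 24, 39` monomials).  In the desk's typed
currency (R2102/R2114: `c`, `e` symmetric tables, `c = 0` off the band, `0 < c i i`): `exists_static_definite_tridiagonal_six` … `_nine` and
`not_posRoots_le_edges_static_tridiagonal_six` … `_nine` (¬ «≤ m − 1»).  Located context: no instance with MORE than `m` zeros is known
(memo §4) — the sharp linear law may be `B m = m` (`m ≥ 5`).
[data of this seat] explicit matrices; [folklore] intermediate value theorem, certificates by `norm_num`.
-/

-- `Summit.ValiantsHypothesis.ValiantsHypothesis.…` repeats a component by the D-0017 layout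
-- (single-conjunct summit), which the `dupNamespace` linter flags; the name is mandated.
set_option linter.dupNamespace false

namespace Summit.ValiantsHypothesis.ValiantsHypothesis.Theorems.KPlusLogSqLaw.StaticTridiagonalReal

open scoped BigOperators Matrix
open Polynomial
open Summit.ValiantsHypothesis.ValiantsHypothesis.Theorems.ValuativeFlip (ctK ctPath ctPath_apply ctK_add_two ctK_zero ctK_one)
open Summit.ValiantsHypothesis.ValiantsHypothesis.Theorems.SymmetroidDescartes (le_card_posRoots_of_alternating)

/-- Closed form of the determinant of the size-`6` prefix of the chain (degree `25`, `9` monomials), through `det_ctPath`.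
[data of this seat] -/
theorem eval_det_six (t : ℝ) :
    ((ctPath
      (fun t : ℕ => if t = 0 then (X : ℝ[X]) else if t = 1 then (1 : ℝ[X]) else if t = 2 then (C (4 : ℝ) * X : ℝ[X]) else if t = 3 then (1 : ℝ[X]) else if t = 4 then (1 : ℝ[X]) else if t = 5 then (C (64 : ℝ) * X ^ 12 : ℝ[X]) else if t = 6 then (C (4 : ℝ) : ℝ[X]) else if t = 7 then (C (1024 : ℝ) * X ^ 100 : ℝ[X]) else if t = 8 then (C (64 : ℝ) : ℝ[X]) else (0 : ℝ[X]))
      (fun t : ℕ => if t = 0 then (1 : ℝ[X]) else if t = 1 then (X : ℝ[X]) else if t = 2 then (C (4 : ℝ) * X : ℝ[X]) else if t = 3 then (X ^ 5 : ℝ[X]) else if t = 4 then (1 : ℝ[X]) else if t = 5 then (X ^ 26 : ℝ[X]) else if t = 6 then (1 : ℝ[X]) else if t = 7 then (X ^ 250 : ℝ[X]) else (0 : ℝ[X]))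
      (fun t : ℕ => if t = 0 then (0 : ℝ[X]) else if t = 1 then (1 : ℝ[X]) else if t = 2 then (X : ℝ[X]) else if t = 3 then (C (4 : ℝ) * X : ℝ[X]) else if t = 4 then (X ^ 5 : ℝ[X]) else if t = 5 then (1 : ℝ[X]) else if t = 6 then (X ^ 26 : ℝ[X]) else if t = 7 then (1 : ℝ[X]) else if t = 8 then (X ^ 250 : ℝ[X]) else (0 : ℝ[X])) 6).det).eval t =
      (64 : ℝ) * t ^ 25 +
      (-256 : ℝ) * t ^ 24 +
      (256 : ℝ) * t ^ 23 +
      (-1088 : ℝ) * t ^ 15 +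
      (1280 : ℝ) * t ^ 14 +
      (-256 : ℝ) * t ^ 13 +
      (17 : ℝ) * t ^ 3 +
      (-20 : ℝ) * t ^ 2 +
      (4 : ℝ) * t ^ 1 := by
  rw [det_ctPath]
  simp only [ctK_add_two, ctK_one, ctK_zero]
  norm_num [eval_add, eval_sub, eval_mul, eval_neg, eval_pow, eval_C, eval_X]
  ring

/-- **`6` distinct positive zeros on `5` edges**: the determinant of the size-`6` prefix alternates in sign (`+,−,+,−,+,−,+`) at
`t = 1/4, 1/2, 1, 5/4, 3/2, 2, 3`. [data of this seat] -/
theorem le_card_posRoots_six :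
    6 ≤ (((ctPath
      (fun t : ℕ => if t = 0 then (X : ℝ[X]) else if t = 1 then (1 : ℝ[X]) else if t = 2 then (C (4 : ℝ) * X : ℝ[X]) else if t = 3 then (1 : ℝ[X]) else if t = 4 then (1 : ℝ[X]) else if t = 5 then (C (64 : ℝ) * X ^ 12 : ℝ[X]) else if t = 6 then (C (4 : ℝ) : ℝ[X]) else if t = 7 then (C (1024 : ℝ) * X ^ 100 : ℝ[X]) else if t = 8 then (C (64 : ℝ) : ℝ[X]) else (0 : ℝ[X]))
      (fun t : ℕ => if t = 0 then (1 : ℝ[X]) else if t = 1 then (X : ℝ[X]) else if t = 2 then (C (4 : ℝ) * X : ℝ[X]) else if t = 3 then (X ^ 5 : ℝ[X]) else if t = 4 then (1 : ℝ[X]) else if t = 5 then (X ^ 26 : ℝ[X]) else if t = 6 then (1 : ℝ[X]) else if t = 7 then (X ^ 250 : ℝ[X]) else (0 : ℝ[X]))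
      (fun t : ℕ => if t = 0 then (0 : ℝ[X]) else if t = 1 then (1 : ℝ[X]) else if t = 2 then (X : ℝ[X]) else if t = 3 then (C (4 : ℝ) * X : ℝ[X]) else if t = 4 then (X ^ 5 : ℝ[X]) else if t = 5 then (1 : ℝ[X]) else if t = 6 then (X ^ 26 : ℝ[X]) else if t = 7 then (1 : ℝ[X]) else if t = 8 then (X ^ 250 : ℝ[X]) else (0 : ℝ[X])) 6).det).roots.toFinset.filter (fun t => 0 < t)).card := by
  refine le_card_posRoots_of_alternating _ 6
    (![1/4, 1/2, 1, 5/4, 3/2, 2, 3] : Fin 7 → ℝ) ?_ ?_ ?_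
  · refine Fin.strictMono_iff_lt_succ.2 fun j => ?_
    fin_cases j <;> simp only [Fin.castSucc_mk, Fin.succ_mk] <;> norm_num
  · intro j; fin_cases j <;> norm_num
  · intro j; fin_cases j <;> simp only [eval_det_six, Fin.castSucc_mk, Fin.succ_mk] <;> norm_num

/-- The size-`6` prefix in the desk's typed currency: the monomial matrix of the coefficient/exponent tables below is the path matrix of
`eval_det_six`. [data of this seat] -/
theorem of_eq_ctPath_six :
    (Matrix.of fun i j : Fin 6 =>
        C (((fun i j : Fin 6 => (if (j : ℕ) = i then (fun t : ℕ => if t = 0 then 1 else if t = 1 then 1 else if t = 2 then 4 else if t = 3 then 1 else if t = 4 then 1 else if t = 5 then 64 else if t = 6 then 4 else if t = 7 then 1024 else if t = 8 then 64 else 0) i else if (j : ℕ) = i + 1 then (fun t : ℕ => if t = 0 then 1 else if t = 1 then 1 else if t = 2 then 4 else if t = 3 then 1 else if t = 4 then 1 else if t = 5 then 1 else if t = 6 then 1 else if t = 7 then 1 else 0) i else if (i : ℕ) = j + 1 then (fun t : ℕ => if t = 0 then 1 else if t = 1 then 1 else if t = 2 then 4 else if t = 3 then 1 else if t = 4 then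 1 else if t = 5 then 1 else if t = 6 then 1 else if t = 7 then 1 else 0) j else 0 : ℕ)) i j : ℕ) : ℝ) * (X : ℝ[X]) ^ ((fun i j : Fin 6 => (if (j : ℕ) = i then (fun t : ℕ => if t = 0 then 1 else if t = 1 then 0 else if t = 2 then 1 else if t = 3 then 0 else if t = 4 then 0 else if t = 5 then 12 else if t = 6 then 0 else if t = 7 then 100 else if t = 8 then 0 else 0) i else if (j : ℕ) = i + 1 then (fun t : ℕ => if t = 0 then 0 else if t = 1 then 1 else if t = 2 then 1 else if t = 3 then 5 else if t = 4 then 0 else if t = 5 then 26 else if t = 6 then 0 else if t = 7 then 250 else 0) i else if (i : ℕ) = j + 1 then (fun t : ℕ => if t = 0 then 0 else if t = 1 then 1 else if t = 2 then 1 else if t = 3 then 5 else if t = 4 then 0 else if t = 5 then 26 else if t = 6 then 0 else if t = 7 then 250 else 0) j else 0 : ℕ)) i j)) =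
      (ctPath
      (fun t : ℕ => if t = 0 then (X : ℝ[X]) else if t = 1 then (1 : ℝ[X]) else if t = 2 then (C (4 : ℝ) * X : ℝ[X]) else if t = 3 then (1 : ℝ[X]) else if t = 4 then (1 : ℝ[X]) else if t = 5 then (C (64 : ℝ) * X ^ 12 : ℝ[X]) else if t = 6 then (C (4 : ℝ) : ℝ[X]) else if t = 7 then (C (1024 : ℝ) * X ^ 100 : ℝ[X]) else if t = 8 then (C (64 : ℝ) : ℝ[X]) else (0 : ℝ[X]))
      (fun t : ℕ => if t = 0 then (1 : ℝ[X]) else if t = 1 then (X : ℝ[X]) else if t = 2 then (C (4 : ℝ) * X : ℝ[X]) else if t = 3 then (X ^ 5 : ℝ[X]) else if t = 4 then (1 : ℝ[X]) else if t = 5 then (X ^ 26 : ℝ[X]) else if t = 6 then (1 : ℝ[X]) else if t = 7 then (X ^ 250 : ℝ[X]) else (0 : ℝ[X]))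
      (fun t : ℕ => if t = 0 then (0 : ℝ[X]) else if t = 1 then (1 : ℝ[X]) else if t = 2 then (X : ℝ[X]) else if t = 3 then (C (4 : ℝ) * X : ℝ[X]) else if t = 4 then (X ^ 5 : ℝ[X]) else if t = 5 then (1 : ℝ[X]) else if t = 6 then (X ^ 26 : ℝ[X]) else if t = 7 then (1 : ℝ[X]) else if t = 8 then (X ^ 250 : ℝ[X]) else (0 : ℝ[X])) 6) := by
  ext i j
  simp only [Matrix.of_apply, ctPath_apply]
  have hi : (i : ℕ) < 6 := i.isLt
  have hj : (j : ℕ) < 6 := j.isLt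
  by_cases h1 : (j : ℕ) = i
  · simp only [h1, if_true]
    generalize (i : ℕ) = t at hi ⊢
    interval_cases t <;> simp
  · rw [if_neg h1, if_neg h1, if_neg h1]
    by_cases h2 : (j : ℕ) = i + 1
    · simp only [h2, if_true]
      have hi' : (i : ℕ) < 5 := by omega
      generalize (i : ℕ) = t at hi' ⊢
      interval_cases t <;> simp
    · rw [if_neg h2, if_neg h2, if_neg h2]
      by_cases h3 : (i : ℕ) = j + 1
      · simp only [h3, if_true]
        have hj' : (j : ℕ) < 5 := by omega
        generalize (j : ℕ) = t at hj' ⊢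
        interval_cases t <;> simp
      · rw [if_neg h3, if_neg h3, if_neg h3]
        simp

/-- **A STATIC DEFINITE SYMMETRIC TRIDIAGONAL `6 × 6` MONOMIAL MATRIX WITH `6` POSITIVE DETERMINANT ZEROS** (`5` edges), typed
currency of R2102/R2114. [data of this seat] -/
theorem exists_static_definite_tridiagonal_six :
    ∃ (c : Fin 6 → Fin 6 → ℝ) (e : Fin 6 → Fin 6 → ℕ),
      (∀ i j, c i j = c j i) ∧ (∀ i j, e i j = e j i) ∧
      (∀ i j : Fin 6, (i : ℕ) + 1 < j ∨ (j : ℕ) + 1 < i → c i j = 0) ∧ (∀ i, 0 < c i i) ∧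
      6 ≤ ((Matrix.det (Matrix.of fun i j => C (c i j) * (X : ℝ[X]) ^ (e i j))).roots.toFinset.filter
        (fun t => 0 < t)).card := by
  refine ⟨fun i j => (((fun i j : Fin 6 => (if (j : ℕ) = i then (fun t : ℕ => if t = 0 then 1 else if t = 1 then 1 else if t = 2 then 4 else if t = 3 then 1 else if t = 4 then 1 else if t = 5 then 64 else if t = 6 then 4 else if t = 7 then 1024 else if t = 8 then 64 else 0) i else if (j : ℕ) = i + 1 then (fun t : ℕ => if t = 0 then 1 else if t = 1 then 1 else if t = 2 then 4 else if t = 3 then 1 else if t = 4 then 1 else if t = 5 then 1 else if t = 6 then 1 else if t = 7 then 1 else 0) i else if (i : ℕ) = j + 1 then (fun t : ℕ => if t = 0 then 1 else if t = 1 then 1 else if t = 2 then 4 else if t = 3 then 1 else if t = 4 then 1 else if t = 5 then 1 else if t = 6 then 1 else if t = 7 then 1 else 0) j else 0 : ℕ)) i j : ℕ) : ℝ), (fun i j : Fin 6 => (if (j : ℕ) = i then (fun t : ℕ => if t = 0 then 1 else if t = 1 then 0 else if t = 2 then 1 else if t = 3 then 0 else if t = 4 then 0 else if t = 5 then 12 else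 if t = 6 then 0 else if t = 7 then 100 else if t = 8 then 0 else 0) i else if (j : ℕ) = i + 1 then (fun t : ℕ => if t = 0 then 0 else if t = 1 then 1 else if t = 2 then 1 else if t = 3 then 5 else if t = 4 then 0 else if t = 5 then 26 else if t = 6 then 0 else if t = 7 then 250 else 0) i else if (i : ℕ) = j + 1 then (fun t : ℕ => if t = 0 then 0 else if t = 1 then 1 else if t = 2 then 1 else if t = 3 then 5 else if t = 4 then 0 else if t = 5 then 26 else if t = 6 then 0 else if t = 7 then 250 else 0) j else 0 : ℕ)), ?_, ?_, ?_, ?_, ?_⟩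
  · have h : ∀ i j : Fin 6, (fun i j : Fin 6 => (if (j : ℕ) = i then (fun t : ℕ => if t = 0 then 1 else if t = 1 then 1 else if t = 2 then 4 else if t = 3 then 1 else if t = 4 then 1 else if t = 5 then 64 else if t = 6 then 4 else if t = 7 then 1024 else if t = 8 then 64 else 0) i else if (j : ℕ) = i + 1 then (fun t : ℕ => if t = 0 then 1 else if t = 1 then 1 else if t = 2 then 4 else if t = 3 then 1 else if t = 4 then 1 else if t = 5 then 1 else if t = 6 then 1 else if t = 7 then 1 else 0) i else if (i : ℕ) = j + 1 then (fun t : ℕ => if t = 0 then 1 else if t = 1 then 1 else if t = 2 then 4 else if t = 3 then 1 else if t = 4 then 1 else if t = 5 then 1 else if t = 6 then 1 else if t = 7 then 1 else 0) j else 0 : ℕ)) i j = (fun i j : Fin 6 => (if (j : ℕ) = i then (fun t : ℕ => if t = 0 then 1 else if t = 1 then 1 else if t = 2 then 4 else if t = 3 then 1 else if t = 4 then 1 else if t = 5 then 64 else if t = 6 then 4 else if t = 7 then 1024 else if t = 8 then 64 else 0) i else if (j : ℕ) = i + 1 then (fun t : ℕ => if t = 0 then 1 else if t = 1 then 1 else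 if t = 2 then 4 else if t = 3 then 1 else if t = 4 then 1 else if t = 5 then 1 else if t = 6 then 1 else if t = 7 then 1 else 0) i else if (i : ℕ) = j + 1 then (fun t : ℕ => if t = 0 then 1 else if t = 1 then 1 else if t = 2 then 4 else if t = 3 then 1 else if t = 4 then 1 else if t = 5 then 1 else if t = 6 then 1 else if t = 7 then 1 else 0) j else 0 : ℕ)) j i := by decide
    intro i j
    exact congrArg (Nat.cast (R := ℝ)) (h i j)
  · decide
  · have h : ∀ i j : Fin 6, (i : ℕ) + 1 < j ∨ (j : ℕ) + 1 < i → (fun i j : Fin 6 => (if (j : ℕ) = i then (fun t : ℕ => if t = 0 then 1 else if t = 1 then 1 else if t = 2 then 4 else if t = 3 then 1 else if t = 4 then 1 else if t = 5 then 64 else if t = 6 then 4 else if t = 7 then 1024 else if t = 8 then 64 else 0) i else if (j : ℕ) = i + 1 then (fun t : ℕ => if t = 0 then 1 else if t = 1 then 1 else if t = 2 then 4 else if t = 3 then 1 else if t = 4 then 1 else if t = 5 then 1 else if t = 6 then 1 else if t = 7 then 1 else 0) i else if (i : ℕ) = j + 1 then (fun t : ℕ => if t = 0 then 1 else if t = 1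 then 1 else if t = 2 then 4 else if t = 3 then 1 else if t = 4 then 1 else if t = 5 then 1 else if t = 6 then 1 else if t = 7 then 1 else 0) j else 0 : ℕ)) i j = 0 := by decide
    intro i j hij
    have h' := h i j hij
    beta_reduce at h' ⊢
    rw [h', Nat.cast_zero]
  · have h : ∀ i : Fin 6, 0 < (fun i j : Fin 6 => (if (j : ℕ) = i then (fun t : ℕ => if t = 0 then 1 else if t = 1 then 1 else if t = 2 then 4 else if t = 3 then 1 else if t = 4 then 1 else if t = 5 then 64 else if t = 6 then 4 else if t = 7 then 1024 else if t = 8 then 64 else 0) i else if (j : ℕ) = i + 1 then (fun t : ℕ => if t = 0 then 1 else if t = 1 then 1 else if t = 2 then 4 else if t = 3 then 1 else if t = 4 then 1 else if t = 5 then 1 else if t = 6 then 1 else if t = 7 then 1 else 0) i else if (i : ℕ) = j + 1 then (fun t : ℕ => if t = 0 then 1 else if t = 1 then 1 else if t = 2 then 4 else if t = 3 then 1 else if t = 4 then 1 else if t = 5 then 1 else if t = 6 then 1 else if t = 7 then 1 else 0) j else 0 : ℕ)) i i := by decide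
    intro i
    have h' := h i
    beta_reduce at h' ⊢
    exact_mod_cast h'
  · rw [of_eq_ctPath_six]
    exact le_card_posRoots_six

/-- ¬ «one zero per edge» at `m = 6`: some static definite symmetric tridiagonal `6 × 6` monomial matrix has more than `6 − 1` distinct
positive determinant zeros. [corollary] -/
theorem not_posRoots_le_edges_static_tridiagonal_six :
    ¬ (∀ (c : Fin 6 → Fin 6 → ℝ) (e : Fin 6 → Fin 6 → ℕ), (∀ i j, c i j = c j i) → (∀ i j, e i j = e j i) →
        (∀ i j : Fin 6, (i : ℕ) + 1 < j ∨ (j : ℕ) + 1 < i → c i j = 0) → (∀ i, 0 < c i i) →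
        ((Matrix.det (Matrix.of fun i j => C (c i j) * (X : ℝ[X]) ^ (e i j))).roots.toFinset.filter
          (fun t => 0 < t)).card ≤ 6 - 1) := by
  intro h
  obtain ⟨c, e, hc, he, htri, hpos, hm⟩ := exists_static_definite_tridiagonal_six
  have := h c e hc he htri hpos
  omega

/-- Closed form of the determinant of the size-`7` prefix of the chain (degree `65`, `15` monomials), through `det_ctPath`.
[data of this seat] -/
theorem eval_det_seven (t : ℝ) :
    ((ctPath
      (fun t : ℕ => if t = 0 then (X : ℝ[X]) else if t = 1 then (1 : ℝ[X]) else if t = 2 then (C (4 : ℝ) * X : ℝ[X]) else if t = 3 then (1 : ℝ[X]) else if t = 4 then (1 : ℝ[X]) else if t = 5 then (C (64 : ℝ) * X ^ 12 : ℝ[X]) else if t = 6 then (C (4 : ℝ) : ℝ[X]) else if t = 7 then (C (1024 : ℝ) * X ^ 100 : ℝ[X]) else if t = 8 then (C (64 : ℝ) : ℝ[X]) else (0 : ℝ[X]))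
      (fun t : ℕ => if t = 0 then (1 : ℝ[X]) else if t = 1 then (X : ℝ[X]) else if t = 2 then (C (4 : ℝ) * X : ℝ[X]) else if t = 3 then (X ^ 5 : ℝ[X]) else if t = 4 then (1 : ℝ[X]) else if t = 5 then (X ^ 26 : ℝ[X]) else if t = 6 then (1 : ℝ[X]) else if t = 7 then (X ^ 250 : ℝ[X]) else (0 : ℝ[X]))
      (fun t : ℕ => if t = 0 then (0 : ℝ[X]) else if t = 1 then (1 : ℝ[X]) else if t = 2 then (X : ℝ[X]) else if t = 3 then (C (4 : ℝ) * X : ℝ[X]) else if t = 4 then (X ^ 5 : ℝ[X]) else if t = 5 then (1 : ℝ[X]) else if t = 6 then (X ^ 26 : ℝ[X]) else if t = 7 then (1 : ℝ[X]) else if t = 8 then (X ^ 250 : ℝ[X]) else (0 : ℝ[X])) 7).det).eval t =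
      (-1 : ℝ) * t ^ 65 +
      (4 : ℝ) * t ^ 64 +
      (-4 : ℝ) * t ^ 63 +
      (17 : ℝ) * t ^ 55 +
      (-20 : ℝ) * t ^ 54 +
      (4 : ℝ) * t ^ 53 +
      (256 : ℝ) * t ^ 25 +
      (-1024 : ℝ) * t ^ 24 +
      (1024 : ℝ) * t ^ 23 +
      (-4352 : ℝ) * t ^ 15 +
      (5120 : ℝ) * t ^ 14 +
      (-1024 : ℝ) * t ^ 13 +
      (68 : ℝ) * t ^ 3 +
      (-80 : ℝ) * t ^ 2 +
      (16 : ℝ) * t ^ 1 := by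
  rw [det_ctPath]
  simp only [ctK_add_two, ctK_one, ctK_zero]
  norm_num [eval_add, eval_sub, eval_mul, eval_neg, eval_pow, eval_C, eval_X]
  ring

/-- **`7` distinct positive zeros on `6` edges**: the determinant of the size-`7` prefix alternates in sign (`+,−,+,−,+,−,+,−`) at
`t = 1/4, 1/2, 1, 9/8, 5/4, 3/2, 2, 3`. [data of this seat] -/
theorem le_card_posRoots_seven :
    7 ≤ (((ctPath
      (fun t : ℕ => if t = 0 then (X : ℝ[X]) else if t = 1 then (1 : ℝ[X]) else if t = 2 then (C (4 : ℝ) * X : ℝ[X]) else if t = 3 then (1 : ℝ[X]) else if t = 4 then (1 : ℝ[X]) else if t = 5 then (C (64 : ℝ) * X ^ 12 : ℝ[X]) else if t = 6 then (C (4 : ℝ) : ℝ[X]) else if t = 7 then (C (1024 : ℝ) * X ^ 100 : ℝ[X]) else if t = 8 then (C (64 : ℝ) : ℝ[X]) else (0 : ℝ[X]))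
      (fun t : ℕ => if t = 0 then (1 : ℝ[X]) else if t = 1 then (X : ℝ[X]) else if t = 2 then (C (4 : ℝ) * X : ℝ[X]) else if t = 3 then (X ^ 5 : ℝ[X]) else if t = 4 then (1 : ℝ[X]) else if t = 5 then (X ^ 26 : ℝ[X]) else if t = 6 then (1 : ℝ[X]) else if t = 7 then (X ^ 250 : ℝ[X]) else (0 : ℝ[X]))
      (fun t : ℕ => if t = 0 then (0 : ℝ[X]) else if t = 1 then (1 : ℝ[X]) else if t = 2 then (X : ℝ[X]) else if t = 3 then (C (4 : ℝ) * X : ℝ[X]) else if t = 4 then (X ^ 5 : ℝ[X]) else if t = 5 then (1 : ℝ[X]) else if t = 6 then (X ^ 26 : ℝ[X]) else if t = 7 then (1 : ℝ[X]) else if t = 8 then (X ^ 250 : ℝ[X]) else (0 : ℝ[X])) 7).det).roots.toFinset.filter (fun t => 0 < t)).card := by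
  refine le_card_posRoots_of_alternating _ 7
    (![1/4, 1/2, 1, 9/8, 5/4, 3/2, 2, 3] : Fin 8 → ℝ) ?_ ?_ ?_
  · refine Fin.strictMono_iff_lt_succ.2 fun j => ?_
    fin_cases j <;> simp only [Fin.castSucc_mk, Fin.succ_mk] <;> norm_num
  · intro j; fin_cases j <;> norm_num
  · intro j; fin_cases j <;> simp only [eval_det_seven, Fin.castSucc_mk, Fin.succ_mk] <;> norm_num

/-- The size-`7` prefix in the desk's typed currency: the monomial matrix of the coefficient/exponent tables below is the path matrix of
`eval_det_seven`. [data of this seat] -/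
theorem of_eq_ctPath_seven :
    (Matrix.of fun i j : Fin 7 =>
        C (((fun i j : Fin 7 => (if (j : ℕ) = i then (fun t : ℕ => if t = 0 then 1 else if t = 1 then 1 else if t = 2 then 4 else if t = 3 then 1 else if t = 4 then 1 else if t = 5 then 64 else if t = 6 then 4 else if t = 7 then 1024 else if t = 8 then 64 else 0) i else if (j : ℕ) = i + 1 then (fun t : ℕ => if t = 0 then 1 else if t = 1 then 1 else if t = 2 then 4 else if t = 3 then 1 else if t = 4 then 1 else if t = 5 then 1 else if t = 6 then 1 else if t = 7 then 1 else 0) i else if (i : ℕ) = j + 1 then (fun t : ℕ => if t = 0 then 1 else if t = 1 then 1 else if t = 2 then 4 else if t = 3 then 1 else if t = 4 then 1 else if t = 5 then 1 else if t = 6 then 1 else if t = 7 then 1 else 0) j else 0 : ℕ)) i j : ℕ) : ℝ) * (X : ℝ[X]) ^ ((fun i j : Fin 7 => (if (j : ℕ) = i then (fun t : ℕ => if t = 0 then 1 else if t = 1 then 0 else if t = 2 then 1 else if t = 3 then 0 else if t = 4 then 0 else if t = 5 then 12 else if t = 6 then 0 else if t = 7 then 100 else if t = 8 then 0 else 0)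 i else if (j : ℕ) = i + 1 then (fun t : ℕ => if t = 0 then 0 else if t = 1 then 1 else if t = 2 then 1 else if t = 3 then 5 else if t = 4 then 0 else if t = 5 then 26 else if t = 6 then 0 else if t = 7 then 250 else 0) i else if (i : ℕ) = j + 1 then (fun t : ℕ => if t = 0 then 0 else if t = 1 then 1 else if t = 2 then 1 else if t = 3 then 5 else if t = 4 then 0 else if t = 5 then 26 else if t = 6 then 0 else if t = 7 then 250 else 0) j else 0 : ℕ)) i j)) =
      (ctPath
      (fun t : ℕ => if t = 0 then (X : ℝ[X]) else if t = 1 then (1 : ℝ[X]) else if t = 2 then (C (4 : ℝ) * X : ℝ[X]) else if t = 3 then (1 : ℝ[X]) else if t = 4 then (1 : ℝ[X]) else if t = 5 then (C (64 : ℝ) * X ^ 12 : ℝ[X]) else if t = 6 then (C (4 : ℝ) : ℝ[X]) else if t = 7 then (C (1024 : ℝ) * X ^ 100 : ℝ[X]) else if t = 8 then (C (64 : ℝ) : ℝ[X]) else (0 : ℝ[X]))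
      (fun t : ℕ => if t = 0 then (1 : ℝ[X]) else if t = 1 then (X : ℝ[X]) else if t = 2 then (C (4 : ℝ) * X : ℝ[X]) else if t = 3 then (X ^ 5 : ℝ[X]) else if t = 4 then (1 : ℝ[X]) else if t = 5 then (X ^ 26 : ℝ[X]) else if t = 6 then (1 : ℝ[X]) else if t = 7 then (X ^ 250 : ℝ[X]) else (0 : ℝ[X]))
      (fun t : ℕ => if t = 0 then (0 : ℝ[X]) else if t = 1 then (1 : ℝ[X]) else if t = 2 then (X : ℝ[X]) else if t = 3 then (C (4 : ℝ) * X : ℝ[X]) else if t = 4 then (X ^ 5 : ℝ[X]) else if t = 5 then (1 : ℝ[X]) else if t = 6 then (X ^ 26 : ℝ[X]) else if t = 7 then (1 : ℝ[X]) else if t = 8 then (X ^ 250 : ℝ[X]) else (0 : ℝ[X])) 7) := by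
  ext i j
  simp only [Matrix.of_apply, ctPath_apply]
  have hi : (i : ℕ) < 7 := i.isLt
  have hj : (j : ℕ) < 7 := j.isLt
  by_cases h1 : (j : ℕ) = i
  · simp only [h1, if_true]
    generalize (i : ℕ) = t at hi ⊢
    interval_cases t <;> simp
  · rw [if_neg h1, if_neg h1, if_neg h1]
    by_cases h2 : (j : ℕ) = i + 1
    · simp only [h2, if_true]
      have hi' : (i : ℕ) < 6 := by omega
      generalize (i : ℕ) = t at hi' ⊢
      interval_cases t <;> simp
    · rw [if_neg h2, if_neg h2, if_neg h2]
      by_cases h3 : (i : ℕ) = j + 1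
      · simp only [h3, if_true]
        have hj' : (j : ℕ) < 6 := by omega
        generalize (j : ℕ) = t at hj' ⊢
        interval_cases t <;> simp
      · rw [if_neg h3, if_neg h3, if_neg h3]
        simp

/-- **A STATIC DEFINITE SYMMETRIC TRIDIAGONAL `7 × 7` MONOMIAL MATRIX WITH `7` POSITIVE DETERMINANT ZEROS** (`6` edges), typed
currency of R2102/R2114. [data of this seat] -/
theorem exists_static_definite_tridiagonal_seven :
    ∃ (c : Fin 7 → Fin 7 → ℝ) (e : Fin 7 → Fin 7 → ℕ),
      (∀ i j, c i j = c j i) ∧ (∀ i j, e i j = e j i) ∧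
      (∀ i j : Fin 7, (i : ℕ) + 1 < j ∨ (j : ℕ) + 1 < i → c i j = 0) ∧ (∀ i, 0 < c i i) ∧
      7 ≤ ((Matrix.det (Matrix.of fun i j => C (c i j) * (X : ℝ[X]) ^ (e i j))).roots.toFinset.filter
        (fun t => 0 < t)).card := by
  refine ⟨fun i j => (((fun i j : Fin 7 => (if (j : ℕ) = i then (fun t : ℕ => if t = 0 then 1 else if t = 1 then 1 else if t = 2 then 4 else if t = 3 then 1 else if t = 4 then 1 else if t = 5 then 64 else if t = 6 then 4 else if t = 7 then 1024 else if t = 8 then 64 else 0) i else if (j : ℕ) = i + 1 then (fun t : ℕ => if t = 0 then 1 else if t = 1 then 1 else if t = 2 then 4 else if t = 3 then 1 else if t = 4 then 1 else if t = 5 then 1 else if t = 6 then 1 else if t = 7 then 1 else 0) i else if (i : ℕ) = j + 1 then (fun t : ℕ => if t = 0 then 1 else if t = 1 then 1 else if t = 2 then 4 else if t = 3 then 1 else if t = 4 then 1 else if t = 5 then 1 else if t = 6 then 1 else if t = 7 then 1 else 0) j else 0 : ℕ)) i j : ℕ) : ℝ), (fun i j : Fin 7 => (if (j : ℕ) = i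 then (fun t : ℕ => if t = 0 then 1 else if t = 1 then 0 else if t = 2 then 1 else if t = 3 then 0 else if t = 4 then 0 else if t = 5 then 12 else if t = 6 then 0 else if t = 7 then 100 else if t = 8 then 0 else 0) i else if (j : ℕ) = i + 1 then (fun t : ℕ => if t = 0 then 0 else if t = 1 then 1 else if t = 2 then 1 else if t = 3 then 5 else if t = 4 then 0 else if t = 5 then 26 else if t = 6 then 0 else if t = 7 then 250 else 0) i else if (i : ℕ) = j + 1 then (fun t : ℕ => if t = 0 then 0 else if t = 1 then 1 else if t = 2 then 1 else if t = 3 then 5 else if t = 4 then 0 else if t = 5 then 26 else if t = 6 then 0 else if t = 7 then 250 else 0) j else 0 : ℕ)), ?_, ?_, ?_, ?_, ?_⟩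
  · have h : ∀ i j : Fin 7, (fun i j : Fin 7 => (if (j : ℕ) = i then (fun t : ℕ => if t = 0 then 1 else if t = 1 then 1 else if t = 2 then 4 else if t = 3 then 1 else if t = 4 then 1 else if t = 5 then 64 else if t = 6 then 4 else if t = 7 then 1024 else if t = 8 then 64 else 0) i else if (j : ℕ) = i + 1 then (fun t : ℕ => if t = 0 then 1 else if t = 1 then 1 else if t = 2 then 4 else if t = 3 then 1 else if t = 4 then 1 else if t = 5 then 1 else if t = 6 then 1 else if t = 7 then 1 else 0) i else if (i : ℕ) = j + 1 then (fun t : ℕ => if t = 0 then 1 else if t = 1 then 1 else if t = 2 then 4 else if t = 3 then 1 else if t = 4 then 1 else if t = 5 then 1 else if t = 6 then 1 else if t = 7 then 1 else 0) j else 0 : ℕ)) i j = (fun i j : Fin 7 => (if (j : ℕ) = i then (fun t : ℕ => if t = 0 then 1 else if t = 1 then 1 else if t = 2 then 4 else if t = 3 then 1 else if t = 4 then 1 else if t = 5 then 64 else if t = 6 then 4 else if t = 7 then 1024 else if t = 8 then 64 else 0) i else if (j : ℕ) = i + 1 then (fun t : ℕ => if t = 0 then 1 else if t = 1 then 1 else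 if t = 2 then 4 else if t = 3 then 1 else if t = 4 then 1 else if t = 5 then 1 else if t = 6 then 1 else if t = 7 then 1 else 0) i else if (i : ℕ) = j + 1 then (fun t : ℕ => if t = 0 then 1 else if t = 1 then 1 else if t = 2 then 4 else if t = 3 then 1 else if t = 4 then 1 else if t = 5 then 1 else if t = 6 then 1 else if t = 7 then 1 else 0) j else 0 : ℕ)) j i := by decide
    intro i j
    exact congrArg (Nat.cast (R := ℝ)) (h i j)
  · decide
  · have h : ∀ i j : Fin 7, (i : ℕ) + 1 < j ∨ (j : ℕ) + 1 < i → (fun i j : Fin 7 => (if (j : ℕ) = i then (fun t : ℕ => if t = 0 then 1 else if t = 1 then 1 else if t = 2 then 4 else if t = 3 then 1 else if t = 4 then 1 else if t = 5 then 64 else if t = 6 then 4 else if t = 7 then 1024 else if t = 8 then 64 else 0) i else if (j : ℕ) = i + 1 then (fun t : ℕ => if t = 0 then 1 else if t = 1 then 1 else if t = 2 then 4 else if t = 3 then 1 else if t = 4 then 1 else if t = 5 then 1 else if t = 6 then 1 else if t = 7 then 1 else 0) i else if (i : ℕ) = j + 1 then (fun t : ℕ => if t = 0 then 1 else if t = 1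 then 1 else if t = 2 then 4 else if t = 3 then 1 else if t = 4 then 1 else if t = 5 then 1 else if t = 6 then 1 else if t = 7 then 1 else 0) j else 0 : ℕ)) i j = 0 := by decide
    intro i j hij
    have h' := h i j hij
    beta_reduce at h' ⊢
    rw [h', Nat.cast_zero]
  · have h : ∀ i : Fin 7, 0 < (fun i j : Fin 7 => (if (j : ℕ) = i then (fun t : ℕ => if t = 0 then 1 else if t = 1 then 1 else if t = 2 then 4 else if t = 3 then 1 else if t = 4 then 1 else if t = 5 then 64 else if t = 6 then 4 else if t = 7 then 1024 else if t = 8 then 64 else 0) i else if (j : ℕ) = i + 1 then (fun t : ℕ => if t = 0 then 1 else if t = 1 then 1 else if t = 2 then 4 else if t = 3 then 1 else if t = 4 then 1 else if t = 5 then 1 else if t = 6 then 1 else if t = 7 then 1 else 0) i else if (i : ℕ) = j + 1 then (fun t : ℕ => if t = 0 then 1 else if t = 1 then 1 else if t = 2 then 4 else if t = 3 then 1 else if t = 4 then 1 else if t = 5 then 1 else if t = 6 then 1 else if t = 7 then 1 else 0) j else 0 : ℕ)) i i := by decide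
    intro i
    have h' := h i
    beta_reduce at h' ⊢
    exact_mod_cast h'
  · rw [of_eq_ctPath_seven]
    exact le_card_posRoots_seven

/-- ¬ «one zero per edge» at `m = 7`: some static definite symmetric tridiagonal `7 × 7` monomial matrix has more than `7 − 1` distinct
positive determinant zeros. [corollary] -/
theorem not_posRoots_le_edges_static_tridiagonal_seven :
    ¬ (∀ (c : Fin 7 → Fin 7 → ℝ) (e : Fin 7 → Fin 7 → ℕ), (∀ i j, c i j = c j i) → (∀ i j, e i j = e j i) →
        (∀ i j : Fin 7, (i : ℕ) + 1 < j ∨ (j : ℕ) + 1 < i → c i j = 0) → (∀ i, 0 < c i i) →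
        ((Matrix.det (Matrix.of fun i j => C (c i j) * (X : ℝ[X]) ^ (e i j))).roots.toFinset.filter
          (fun t => 0 < t)).card ≤ 7 - 1) := by
  intro h
  obtain ⟨c, e, hc, he, htri, hpos, hm⟩ := exists_static_definite_tridiagonal_seven
  have := h c e hc he htri hpos
  omega

end Summit.ValiantsHypothesis.ValiantsHypothesis.Theorems.KPlusLogSqLaw.StaticTridiagonalReal
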